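import Summits.ResolutionOfSingularities.ResolutionOfSingularities.Theorems.FrobeniusLadderFInjectiveMacaulayficationRelGddF165Regular
import Summits.ResolutionOfSingularities.ResolutionOfSingularities.Theorems.FrobeniusLadderFInjectiveMacaulayficationRelGddF165Cone
import Summits.ResolutionOfSingularities.ResolutionOfSingularities.Theorems.FrobeniusLadderFInjectiveMacaulayficationRelGddF165Direct
import Summits.ResolutionOfSingularities.ResolutionOfSingularities.Theorems.FrobeniusLadderFInjectiveMacaulayficationRelGddF192Model
import Summits.ResolutionOfSingularities.ResolutionOfSingularities.Theorems.FrobeniusLadderFInjectiveMacaulayficationRelGddF008Hpow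
import Summits.ResolutionOfSingularities.ResolutionOfSingularities.Theorems.FrobeniusLadderFInjectiveMacaulayficationFilteredConeFiModelRelDirect
import Literature.AlgebraicGeometry.Resolution.ComponentGluing
import Literature.AlgebraicGeometry.HodgeTheory.CycleClassPrincipalDivisorProjectiveSpaceHolds
import HarnessLib

/-!
# ★ ROWC F165/5 (clone of F192/5): ONE RELATIVE `(2,3,9,3 | 18)`-WEIGHTED BLOW-UP F-INJECTIVELY MACAULAYFIES
# `z² + (y²+x³)³ + x¹¹ + w⁷ + t²yzw² + t·y⁵w = 0`
# over every field of characteristic `5` — the third (D)-CLASS hole-#3 specimen (RULING R16.30 (5): F165 clone)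
# (crux `FInjectiveMacaulayfication` stmt-ResolutionOfSingularities-15315; relative filtered engine v2 `FilteredConeFiModelRelDirect`;
# RULINGS R15.48 (3), R16.6 (2), R16.30 (5) of res-L1-w45a-plan-1)

Support file for crux stmt-ResolutionOfSingularities-15315 (`FrobeniusLadder.FInjectiveMacaulayfication`), chain w45a, seat
res-L1-w45a-stub-4 g6 (engine v2 + instance owner). [OURS · L1 W4.5a; mechanism = the chain's relative filtered engine (res-L1-w45a-lead-1)
re-run with the «cone OR direct» hypothesis; specimen = ROWC row F192 (res-L1-w45a-idea-2), one-step finding res-L1-w45a-stub-4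
19:05:06Z (cross-checked res-L1-w45a-tri-2 #167, res-L1-w45a-idea-2 ROWC v2 (D)); hpow = `RelGddF008Hpow` (same facet)] — NOT a
statement of the manuscript [claim: Hironaka2017]; AI-written, weaker than expert review.

**The specimen.** `F165 = T₁₁ + t²yzw² + t·y⁵w`, `T₁₁ = z² + (y² + x³)³ + x¹¹ + w⁷`, in `k[x,y,z,w,t]`, `char k = 5`: an integral fourfold,
singular exactly along the `t`-axis `L`, whose weighted tangent cone along `L` for the facet `w = (2,3,9,3 | t ↦ 0)` is NOT F-pure
along the orbit `O = {x=y=z=t=0}` — the v1 engine (`filteredConeFiModelRel`) does not apply — and yet the weighted blow-up of `I₁₈` is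
FULL at every stalk: over `O` the extended-Rees chart is F-pure by plain Fedder (`…RelGddF192Direct`, witness `12·w¹¹·t⁴y²z⁴s³`).

**The theorem** (`f165_fInjectiveMacaulayfication_char5`): over every field of characteristic `5`, `Spec k[X]/(F165)` admits a proper
birational model all of whose stalks are domains in which every system of parameters is weakly regular and generates a Frobenius-closed
ideal — the crux statement's conclusion for this `X`.  Proof: graded move `σ : z ↦ z + 2t²yw²` to the diagonal form `g`
(`…RelGddF165Data`); engine v2 `filteredConeFiModelRel_direct` with `J = {x,y,z,w}`, `w = (2,3,9,3,0)`, `N = D = 18`, `c = (9,6,2,6)`,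
`hpow = RelGddF008Hpow.hpow_2393_18`, `hoff = RelGddF165Regular.g_offL_clause_char5`, the deformation
`fh = z² + t⁴y²w⁴ + (y²+x³)³ + t·y⁵w + x¹¹s⁴ + w⁷s³` (`fh_f165`, via `RelGddF192Model.fh_eq_of_sum_monomial`) and `hcone` by cases on the
coordinate pattern of `P′`: over `O` the direct certificate (`RelGddF165Direct.direct_clause`), elsewhere the cone clause
(`RelGddF165Cone.g0_offO_clause_char5`) through the engine's dictionary; then transport along `σ` as in `GxzGradedFiModel`.
No definitions, no named facts, no `decide` tables. [folklore mechanism]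
-/

-- single-problem summit: the doubled namespace component is forced
set_option linter.dupNamespace false

noncomputable section

open AlgebraicGeometry CategoryTheory MvPolynomial
open Literature.AlgebraicGeometry.Resolution

namespace Summit.ResolutionOfSingularities.ResolutionOfSingularities.Theorems.FInjectiveMacaulayfication.RelGddF165Model

open Summit.ResolutionOfSingularities.ResolutionOfSingularities.Theorems.FInjectiveMacaulayfication

/-! ## The deformation `fh` (via `RelGddF192Model.fh_eq_of_sum_monomial`) -/

/-- **The deformation of F165's diagonal form**: `fh = z² + t⁴y²w⁴ + (y²+x³)³ + t·y⁵w + x¹¹s⁴ + w⁷s³` (`s = X none`) is the engine's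
`Σ_{b ∈ supp g} coeff_b(g) X^b s^{w·b − 18}` for `g = z² + t⁴y²w⁴ + (y²+x³)³ + t·y⁵w + x¹¹ + w⁷`, `w = (2,3,9,3,0)`. [folklore] -/
theorem fh_f165 (k : Type) [Field k] (g : MvPolynomial (Fin 5) k)
    (hg : g = X 2 ^ 2 + X 4 ^ 4 * X 1 ^ 2 * X 3 ^ 4 + (X 1 ^ 2 + X 0 ^ 3) ^ 3 + X 4 * X 1 ^ 5 * X 3 + X 0 ^ 11 + X 3 ^ 7) :
    (∑ b ∈ g.support, monomial (Finsupp.mapDomain some b + Finsupp.single none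
        (Finsupp.weight (![2, 3, 9, 3, 0] : Fin 5 → ℕ) b - 18)) (coeff b g) : MvPolynomial (Option (Fin 5)) k) =
      X (some 2) ^ 2 + X (some 4) ^ 4 * X (some 1) ^ 2 * X (some 3) ^ 4 + (X (some 1) ^ 2 + X (some 0) ^ 3) ^ 3
        + X (some 4) * X (some 1) ^ 5 * X (some 3) + X (some 0) ^ 11 * X none ^ 4 + X (some 3) ^ 7 * X none ^ 3 := by
  classical
  -- the nine monomials of `g`
  let e : Fin 9 → (Fin 5 →₀ ℕ) := ![Finsupp.single 2 2, Finsupp.single 4 4 + Finsupp.single 1 2 + Finsupp.single 3 4,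
    Finsupp.single 1 6, Finsupp.single 0 3 + Finsupp.single 1 4, Finsupp.single 0 6 + Finsupp.single 1 2, Finsupp.single 0 9,
    Finsupp.single 4 1 + Finsupp.single 1 5 + Finsupp.single 3 1, Finsupp.single 0 11, Finsupp.single 3 7]
  let c : Fin 9 → k := ![1, 1, 1, 3, 3, 1, 1, 1, 1]
  have hval : ∀ i : Fin 9, ∀ j : Fin 5, e i j = (![![0,0,2,0,0], ![0,2,0,4,4], ![0,6,0,0,0], ![3,4,0,0,0], ![6,2,0,0,0], ![9,0,0,0,0],
      ![0,5,0,1,1], ![11,0,0,0,0], ![0,0,0,7,0]] : Fin 9 → Fin 5 → ℕ) i j := by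
    intro i j
    fin_cases i <;> fin_cases j <;> simp [e]
  have he : Function.Injective e := by
    intro i j hij
    have h := fun l => (hval i l).symm.trans ((Finsupp.ext_iff.mp hij l).trans (hval j l))
    fin_cases i <;> fin_cases j <;> first | rfl | (exfalso; have h0 := h 0; have h1 := h 1; have h2 := h 2; have h3 := h 3; simp at h0 h1 h2 h3)
  have hmon : ∀ (b : Fin 5 →₀ ℕ) (a : k), (monomial b a : MvPolynomial (Fin 5) k) =
      C a * (X 0 ^ b 0 * X 1 ^ b 1 * X 2 ^ b 2 * X 3 ^ b 3 * X 4 ^ b 4) := by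
    intro b a
    rw [monomial_eq, Finsupp.prod_fintype _ _ (fun _ => pow_zero _), Fin.prod_univ_five]
  have hgm : g = ∑ i, monomial (e i) (c i) := by
    rw [Fin.sum_univ_succ, Fin.sum_univ_eight]
    simp only [hmon, hval]
    simp [c, hg, map_ofNat]
    ring
  rw [RelGddF192Model.fh_eq_of_sum_monomial _ 18 e he c g hgm, Fin.sum_univ_succ, Fin.sum_univ_eight]
  have hmon' : ∀ (b : Fin 5 →₀ ℕ) (r : ℕ) (a : k), (monomial (Finsupp.mapDomain some b + Finsupp.single none r) a :
      MvPolynomial (Option (Fin 5)) k) =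
      C a * (X (some 0) ^ b 0 * X (some 1) ^ b 1 * X (some 2) ^ b 2 * X (some 3) ^ b 3 * X (some 4) ^ b 4 * X none ^ r) := by
    intro b r a
    rw [monomial_eq, Finsupp.prod_add_index' (fun _ => pow_zero _) (fun _ _ _ => pow_add _ _ _),
      Finsupp.prod_mapDomain_index (fun _ => pow_zero _) (fun _ _ _ => pow_add _ _ _),
      Finsupp.prod_fintype _ _ (fun _ => pow_zero _), Fin.prod_univ_five]
    simp only [Finsupp.prod_single_index, pow_zero]
  have hwt : ∀ i : Fin 9, Finsupp.weight (![2, 3, 9, 3, 0] : Fin 5 → ℕ) (e i) =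
      (![18, 18, 18, 18, 18, 18, 18, 22, 21] : Fin 9 → ℕ) i := by
    intro i
    rw [RelGddF008Hpow.weight_eq, hval, hval, hval, hval]
    fin_cases i <;> simp
  simp only [hmon', hval, hwt]
  simp [c, map_ofNat]
  ring

/-! ## The instance -/

/-- **F165's diagonal form in ONE relative weighted step at `p = 5`** (engine v2): over every field of characteristic `5`,
`Spec k[X₀,…,X₄]/(g)`, `g = X₂² + X₄⁴X₁²X₃⁴ + (X₁² + X₀³)³ + X₄X₁⁵X₃ + X₀¹¹ + X₃⁷`, admits a proper birational model all of whose stalks are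
domains satisfying the per-stalk clause — the weighted blow-up `affineBlowup (I₁₈ R)` along the `t`-axis. [folklore] -/
theorem g165_filteredFiModel_char5 (k : Type) [Field k] [CharP k 5] (g : MvPolynomial (Fin 5) k)
    (hg : g = X 2 ^ 2 + X 4 ^ 4 * X 1 ^ 2 * X 3 ^ 4 + (X 1 ^ 2 + X 0 ^ 3) ^ 3 + X 4 * X 1 ^ 5 * X 3 + X 0 ^ 11 + X 3 ^ 7) :
    ∃ (X' : Scheme.{0}) (π : X' ⟶ Spec (.of (MvPolynomial (Fin 5) k ⧸ Ideal.span {g}))), IsProper π ∧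
      Literature.AlgebraicGeometry.Resolution.IsBirational π ∧
      ∀ y : X', IsDomain (X'.presheaf.stalk y) ∧ ∀ d : ℕ, ringKrullDim (X'.presheaf.stalk y) = d →
        ∀ s : Fin d → X'.presheaf.stalk y, (Ideal.span (Set.range s)).radical.IsMaximal →
          RingTheory.Sequence.IsWeaklyRegular (X'.presheaf.stalk y) (List.ofFn s) ∧
          ∀ z : X'.presheaf.stalk y, (∃ e : ℕ, z ^ 5 ^ e ∈
              Ideal.span ((fun w : X'.presheaf.stalk y => w ^ 5 ^ e) ''
                (Ideal.span (Set.range s) : Set (X'.presheaf.stalk y)))) →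
            z ∈ Ideal.span (Set.range s) := by
  haveI : Fact (Nat.Prime 5) := ⟨by norm_num⟩
  classical
  -- the initial form and the deformation
  set g₀ : MvPolynomial (Fin 5) k := X 2 ^ 2 + X 4 ^ 4 * X 1 ^ 2 * X 3 ^ 4 + (X 1 ^ 2 + X 0 ^ 3) ^ 3 + X 4 * X 1 ^ 5 * X 3 with hg0
  set gh : MvPolynomial (Option (Fin 5)) k := X (some 2) ^ 2 + X (some 4) ^ 4 * X (some 1) ^ 2 * X (some 3) ^ 4 +
    (X (some 1) ^ 2 + X (some 0) ^ 3) ^ 3 + X (some 4) * X (some 1) ^ 5 * X (some 3) + X (some 0) ^ 11 * X none ^ 4 + X (some 3) ^ 7 * X none ^ 3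
    with hgh
  have hJ : ({0, 1, 2, 3} : Finset (Fin 5)).Nonempty := ⟨0, by simp⟩
  have hwc : ∀ v ∈ ({0, 1, 2, 3} : Finset (Fin 5)), 0 < (![2, 3, 9, 3, 0] : Fin 5 → ℕ) v ∧
      (![9, 6, 2, 6, 0] : Fin 5 → ℕ) v * (![2, 3, 9, 3, 0] : Fin 5 → ℕ) v = 18 := by
    intro v hv
    simp only [Finset.mem_insert, Finset.mem_singleton] at hv
    rcases hv with rfl | rfl | rfl | rfl <;> simp
  have hw0 : ∀ v : Fin 5, v ∉ ({0, 1, 2, 3} : Finset (Fin 5)) → (![2, 3, 9, 3, 0] : Fin 5 → ℕ) v = 0 := by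
    intro v hv
    fin_cases v <;> simp_all
  have hf₀ : g₀ = MvPolynomial.weightedHomogeneousComponent (![2, 3, 9, 3, 0] : Fin 5 → ℕ) 18 g := by
    rw [hg0, RelGddF165Data.weightedHomogeneousComponent_eighteen k g hg]
  have hfh : gh = ∑ b ∈ g.support, MvPolynomial.monomial
      (Finsupp.mapDomain some b + Finsupp.single none (Finsupp.weight (![2, 3, 9, 3, 0] : Fin 5 → ℕ) b - 18))
      (MvPolynomial.coeff b g) := by
    rw [fh_f165 k g hg]
  refine FilteredConeFiModelRelDirect.filteredConeFiModelRel_direct 5 k 5 _ hJ ![2, 3, 9, 3, 0] 18 18 ![9, 6, 2, 6, 0]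
    (by norm_num) hwc hw0 (RelGddF008Hpow.hpow_2393_18 k) g g₀ hf₀ (RelGddF165Data.weightedHomogeneousComponent_lt_eighteen k g hg)
    (hg0 ▸ RelGddF165Data.g0_ne_zero k) (RelGddF165Data.span_g_isPrime k g hg) (RelGddF165Data.g_X_ne_zero k g hg)
    (RelGddF165Regular.g_offL_clause_char5 k g hg) gh hfh ?_
  -- `hcone`: direct certificate over the bad orbit `O = {x=y=z=t=0}`, cone clause elsewhere
  intro v hv P' _ hXv hXs
  by_cases hO : Ideal.Quotient.mk (Ideal.span {gh}) (X (some 0)) ∈ P' ∧ Ideal.Quotient.mk (Ideal.span {gh}) (X (some 1)) ∈ P' ∧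
      Ideal.Quotient.mk (Ideal.span {gh}) (X (some 2)) ∈ P' ∧ Ideal.Quotient.mk (Ideal.span {gh}) (X (some 4)) ∈ P'
  · left
    obtain ⟨h0, h1, h2, h4⟩ := hO
    have h3 : Ideal.Quotient.mk (Ideal.span {gh}) (X (some 3)) ∉ P' := by
      simp only [Finset.mem_insert, Finset.mem_singleton] at hv
      rcases hv with rfl | rfl | rfl | rfl
      · exact absurd h0 hXv
      · exact absurd h1 hXv
      · exact absurd h2 hXv
      · exact hXv
    exact RelGddF165Direct.direct_clause k gh hgh P' h0 h1 h2 h4 hXs h3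
  · right
    intro Q₀ _ hdict
    refine RelGddF165Cone.g0_offO_clause_char5 k g₀ hg0 Q₀ ⟨v, hv, fun h => hXv ((hdict v).mp h)⟩ ?_
    rintro ⟨a0, a1, a2, a4⟩
    exact hO ⟨(hdict 0).mp a0, (hdict 1).mp a1, (hdict 2).mp a2, (hdict 4).mp a4⟩

/-- ★ **F165/5 — ONE RELATIVE WEIGHTED BLOW-UP**: over every field `k` of characteristic `5`, the fourfold
`X₁ = Spec k[X₀,…,X₄]/(X₂² + (X₁² + X₀³)³ + X₀¹¹ + X₃⁷ + X₄²X₁X₂X₃² + X₄X₁⁵X₃)` (ROWC row F165 = `T₁₁ + t²yzw² + t·y⁵w`: bad along the whole `t`-axis,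
weighted tangent cone NOT F-pure along the orbit `{x=y=z=t=0}`) admits a proper birational model all of whose stalks are domains in
which every system of parameters is a weakly regular sequence generating a Frobenius-closed ideal — the conclusion of
`FrobeniusLadder.FInjectiveMacaulayfication` for `X₁` — namely the `(2,3,9,3 | 0)`-weighted blow-up of `I₁₈` along the `t`-axis
(transported from the diagonal form along the graded automorphism `z ↦ z + 2t²yw²`).  Third (D)-class hole-#3 specimen (second clone of the facet template; its cone has TWO singular strata off `V(x,y,z,w)`).
[OURS · mechanism folklore / tree engine v2] -/
theorem f165_fInjectiveMacaulayfication_char5 (k : Type) [Field k] [CharP k 5] (f : MvPolynomial (Fin 5) k)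
    (hf : f = X 2 ^ 2 + (X 1 ^ 2 + X 0 ^ 3) ^ 3 + X 0 ^ 11 + X 3 ^ 7 + X 4 ^ 2 * X 1 * X 2 * X 3 ^ 2 + X 4 * X 1 ^ 5 * X 3) :
    ∃ (X' : Scheme.{0}) (π : X' ⟶ Spec (.of (MvPolynomial (Fin 5) k ⧸ Ideal.span {f}))), IsProper π ∧
      Literature.AlgebraicGeometry.Resolution.IsBirational π ∧
      ∀ y : X', IsDomain (X'.presheaf.stalk y) ∧ ∀ d : ℕ, ringKrullDim (X'.presheaf.stalk y) = d →
        ∀ s : Fin d → X'.presheaf.stalk y, (Ideal.span (Set.range s)).radical.IsMaximal →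
          RingTheory.Sequence.IsWeaklyRegular (X'.presheaf.stalk y) (List.ofFn s) ∧
          ∀ z : X'.presheaf.stalk y, (∃ e : ℕ, z ^ 5 ^ e ∈
              Ideal.span ((fun w : X'.presheaf.stalk y => w ^ 5 ^ e) ''
                (Ideal.span (Set.range s) : Set (X'.presheaf.stalk y)))) →
            z ∈ Ideal.span (Set.range s) := by
  set g : MvPolynomial (Fin 5) k := X 2 ^ 2 + X 4 ^ 4 * X 1 ^ 2 * X 3 ^ 4 + (X 1 ^ 2 + X 0 ^ 3) ^ 3 + X 4 * X 1 ^ 5 * X 3 + X 0 ^ 11 + X 3 ^ 7 with hg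
  obtain ⟨X', π, hπ, hbir, hst⟩ := g165_filteredFiModel_char5 k g hg
  obtain ⟨σ, h0, h1, h2, h3, h4⟩ := RelGddF192Data.exists_sigma k
  have hσf : σ f = g := by rw [hf, hg]; exact RelGddF165Data.sigma_f165_eq k σ h0 h1 h2 h3 h4
  have hmap : Ideal.span {g} = Ideal.map (σ : MvPolynomial (Fin 5) k →+* MvPolynomial (Fin 5) k) (Ideal.span {f}) := by
    rw [Ideal.map_span, Set.image_singleton]
    exact congrArg _ (congrArg _ hσf.symm)
  let e : (MvPolynomial (Fin 5) k ⧸ Ideal.span {f}) ≃+* (MvPolynomial (Fin 5) k ⧸ Ideal.span {g}) :=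
    (Ideal.quotientEquivAlg (Ideal.span {f}) (Ideal.span {g}) σ hmap).toRingEquiv
  let ι : Spec (.of (MvPolynomial (Fin 5) k ⧸ Ideal.span {g})) ⟶ Spec (.of (MvPolynomial (Fin 5) k ⧸ Ideal.span {f})) :=
    Spec.map (CommRingCat.ofHom e.toRingHom)
  haveI : IsIso (CommRingCat.ofHom e.toRingHom) := (e.toCommRingCatIso).isIso_hom
  haveI hι : IsIso ι := inferInstance
  haveI : IsProper π := hπ
  refine ⟨X', π ≫ ι, inferInstance, ?_, hst⟩
  exact IsBirational.comp hbir (Literature.AlgebraicGeometry.HodgeTheory.isBirational_of_isIso ι)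

end Summit.ResolutionOfSingularities.ResolutionOfSingularities.Theorems.FInjectiveMacaulayfication.RelGddF165Model

end
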